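import Summits.CriticalPhenomena.PercolationContinuityZ3.Theorems.PercNearOneGluingNoHeavyLowerTailKnQuestion8FramePAC
import Summits.CriticalPhenomena.PercolationContinuityZ3.Theorems.PercNearOneGluingNoHeavyLowerTailCovTauBridge
import HarnessLib

/-!
# KN Question 8 at `|A| = 3`: THEOREM (T3) (positive association in the frame) for `prodBernoulli`

Support file (`--supports stmt-CriticalPhenomena-4575`, closed crux; independent mathematics on Kozma–Nitzan's Question 8 at
`|A| = 3`), prover `prim-hp-7` (gen 39).  No definitions, no named facts, no sorries; standard axioms.
Memo `prim-ineq-gen-7/FINDING-TSTAR-g12.md` §1.  The finite-sum theorem `PcovJ1.t3_frame` (file `…KnQuestion8FramePAC.lean`,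
two-source induction `CovTau.metaA2_abstract`) read at the world `U = univ` through the dictionary of `…CovTauBridge.lean`
(`CovTau.rC_univ`, `CovTau.rD_univ`, `CovTau.oInd_openEdgeCluster`, `CovTau.sum_weight_ind`, `CovTau.sum_weight_coe_eq_one`):
* `PcovJ1.t3_measure` — for `μ = prodBernoulli p`, owner `x`, observer `o`, pocket observer `v ≠ o`, avoided set `Y`:
  `μ(v↔o, v↮{x}∪Y, x↮Y) · μ(x↔v, x↮Y, o↮{x,v}∪Y) ≤ μ(x↮{o,v}∪Y, o↮{v}∪Y, v↮Y) · μ(x↔o, x↮Y)`,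
  i.e. `ν′(E)·ν′(PV) ≤ ν′(PM ∩ {v↮Y})·ν′(O)` in the frame `ν′ = μ(· | {x,o} ↮ Y)` — the mass piece of prim-ineq-gen-7's PS5-int reduction.
[cite: VandenbergHaggstromKahn2005, Thm. 1.1 (pp. 3–5)] [cite: AhlswedeDaykin1978, Thm. 1] [cite: KozmaNitzan2024, Question 8 (§5.5 p. 36)]
-/

noncomputable section

namespace Summit.CriticalPhenomena.PercolationContinuityZ3.Theorems

namespace PcovJ1

open Literature.Probability.Percolation
open Literature.Probability.Percolation.BHK2006
open Literature.Probability.Percolation.DecisionTree (ind ind_of_mem ind_of_not_mem ind_nonneg)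
open CovTau
open scoped Classical

variable {V : Type*} [Fintype V]

section Measure

open MeasureTheory Literature.Probability.LatticeModels

/-- **THEOREM (T3)** (prim-ineq-gen-7, FINDING-TSTAR-g12 §1) for the product measure `μ = prodBernoulli p` on a finite graph:
for pairwise roles `x` (owner), `o` (observer), `v ≠ o` (pocket observer) and every avoided set `Y`,
`μ(v↔o, v↮x, v↮Y, x↮Y) · μ(x↔v, x↮Y, o↮{x,v}∪Y) ≤ μ(x↮{o,v}∪Y, o↮{v}∪Y, v↮Y) · μ(x↔o, x↮Y)`,
i.e. `ν′(E)·ν′(PV) ≤ ν′(PM ∩ {v↮Y})·ν′(O)` in the frame `ν′ = μ(· | {x,o} ↮ Y)`.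
[cite: VandenbergHaggstromKahn2005, Thm. 1.1 (pp. 3–5)] [cite: KozmaNitzan2024, Question 8 (§5.5 p. 36)] -/
theorem t3_measure (p : Sym2 V → unitInterval) {x o v : V} (hov : o ≠ v) (Y : Set V) :
    (prodBernoulli p).real (openConn v o ∩ {ω : BondConfig V | ∀ t ∈ insert x Y, ¬ (openGraph ω).Reachable v t} ∩
        {ω | ∀ t ∈ Y, ¬ (openGraph ω).Reachable x t}) *
      (prodBernoulli p).real (openConn x v ∩ {ω : BondConfig V | ∀ t ∈ Y, ¬ (openGraph ω).Reachable x t} ∩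
        {ω | ∀ t ∈ insert x (insert v Y), ¬ (openGraph ω).Reachable o t}) ≤
    (prodBernoulli p).real ({ω : BondConfig V | ∀ t ∈ insert o (insert v Y), ¬ (openGraph ω).Reachable x t} ∩
        {ω | ∀ t ∈ insert v Y, ¬ (openGraph ω).Reachable o t} ∩ {ω | ∀ t ∈ Y, ¬ (openGraph ω).Reachable v t}) *
      (prodBernoulli p).real (openConn x o ∩ {ω : BondConfig V | ∀ t ∈ Y, ¬ (openGraph ω).Reachable x t}) := by
  set w : Sym2 V → ℝ := fun e => (p e : ℝ) with hw
  have hw0 : ∀ e, 0 ≤ w e := fun e => (p e).2.1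
  have hw1 : ∀ e, w e ≤ 1 := fun e => (p e).2.2
  have hm : ∑ ω, weight w ω = 1 := sum_weight_coe_eq_one p
  have key := t3_frame w hw0 hw1 hm hov (x := x) Finset.univ (Y := Y) (fun _ _ => Finset.mem_coe.2 (Finset.mem_univ _))
  -- dictionary at `U = univ`
  have e1 : eT w Finset.univ x o v Y = (prodBernoulli p).real (openConn v o ∩
      {ω : BondConfig V | ∀ t ∈ insert x Y, ¬ (openGraph ω).Reachable v t} ∩ {ω | ∀ t ∈ Y, ¬ (openGraph ω).Reachable x t}) := by
    rw [eT, ← sum_weight_ind]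
    refine Finset.sum_congr rfl fun ω _ => ?_
    congr 1
    rw [rC_univ, rD_univ, oInd_openEdgeCluster, ← ind_inter, ← ind_inter]
    refine BystanderBHK.ind_congr ?_
    simp only [Set.mem_inter_iff, mem_avoidAll_singleton, Finset.mem_univ, true_and, rD_univ, Set.mem_setOf_eq]
  have e2 : pvT w Finset.univ x o v Y = (prodBernoulli p).real (openConn x v ∩
      {ω : BondConfig V | ∀ t ∈ Y, ¬ (openGraph ω).Reachable x t} ∩
        {ω | ∀ t ∈ insert x (insert v Y), ¬ (openGraph ω).Reachable o t}) := by
    rw [pvT, ← sum_weight_ind]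
    refine Finset.sum_congr rfl fun ω _ => ?_
    congr 1
    rw [rC_univ, rD_univ, oInd_openEdgeCluster, ← ind_inter, ← ind_inter]
    refine BystanderBHK.ind_congr ?_
    simp only [Set.mem_inter_iff, mem_avoidAll_singleton, Finset.mem_univ, true_and, rD_univ, Set.mem_setOf_eq]
  have e3 : pmT w Finset.univ x o v Y = (prodBernoulli p).real
      ({ω : BondConfig V | ∀ t ∈ insert o (insert v Y), ¬ (openGraph ω).Reachable x t} ∩
        {ω | ∀ t ∈ insert v Y, ¬ (openGraph ω).Reachable o t} ∩ {ω | ∀ t ∈ Y, ¬ (openGraph ω).Reachable v t}) := by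
    rw [pmT, ← sum_weight_ind]
    refine Finset.sum_congr rfl fun ω _ => ?_
    congr 1
    rw [rD_univ, rD_univ, rD_univ, ← ind_inter, ← ind_inter]
  have e4 : Eav w Finset.univ ∅ o x Y = (prodBernoulli p).real (openConn x o ∩
      {ω : BondConfig V | ∀ t ∈ Y, ¬ (openGraph ω).Reachable x t}) := by
    rw [Eav, ← sum_weight_ind]
    refine Finset.sum_congr rfl fun ω _ => ?_
    congr 1
    rw [rC_univ, rD_univ, oInd_openEdgeCluster, ← ind_inter, Set.empty_union]
  rw [e1, e2, e3, e4] at key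
  exact key

end Measure

end PcovJ1

end Summit.CriticalPhenomena.PercolationContinuityZ3.Theorems

end
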